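import Literature.Analysis.FunctionSpaces.TorusFluidGlueProofs
import Literature.Analysis.FunctionSpaces.TorusLinearisedNSEnergy
import Literature.Analysis.FunctionSpaces.TorusTrilinearH1
import Literature.Analysis.FunctionSpaces.TorusClassicalNSUniqueness
import Literature.Analysis.FunctionSpaces.TorusCalculusProofs
import HarnessLib

/-!
# Energy inequality for the bordered linearised steady Navier–Stokes operator on `T³`
# (line `birth`, crux `NeutralTaylorWaves.NonresonantSelection`, stmt-AnomalousDissipation-16294)

Sorry-free discharge of the registered stub `stub_linearisedEnergyIneq` of the skeleton of
`Summit.AnomalousDissipation.AnomalousDissipation.Theses.NeutralTaylorWaves.NonresonantSelection`.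

Fix a viscosity `ν`, a drift `c`, a border unknown `b`, a smooth divergence-free base field `w` on
`T³` with `‖∂ᵢw‖ ≤ G`, a smooth divergence-free test field `v` and a smooth pressure `r`, and put
`F := (w·∇)v + (v·∇)w − νΔv + ∇r − c∂₃v − b∂₃w` (the bordered residual of the steady operator
linearised at `(w, c)`). Pairing `F` with `v` over `T³`:

* `∫ ⟪(w·∇)v, v⟫ = 0` (`div w = 0`, `Torus.integral_inner_convect_self_right_eq_zero`),
* `∫ ⟪∇r, v⟫ = 0` (`div v = 0`, `Torus.integral_inner_gradient_eq_zero_of_isDivFree`),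
* `∫ ⟪∂₃v, v⟫ = 0` (integration by parts, `Torus.integral_inner_partialDeriv_eq_neg`),
* `∫ ⟪Δv, v⟫ = −‖∇v‖₂²` (`Torus.integral_inner_laplacian_self_eq_neg_gradNormSq_of_isSmooth`),

whence the identity `∫ ⟪F, v⟫ = ∫ ⟪(v·∇)w, v⟫ + ν‖∇v‖₂² − b ∫ ⟪v, ∂₃w⟫`
(`nonresonantSelection_energy_pairing_identity`). Cauchy–Schwarz
(`nonresonantSelection_energy_integral_inner_le_sqrt_mul_sqrt`) and the production bound
`|∫ ⟪(v·∇)w, v⟫| ≤ 3G ∫ ‖v‖²` (`Torus.abs_integral_inner_convect_le`) then give the registered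
inequality `ν‖∇v‖₂² ≤ ‖F‖₂‖v‖₂ + 3G‖v‖₂² + |b|·|∫ ⟪v, ∂₃w⟫|` (`stub_linearisedEnergyIneq`).

References: P. Constantin, C. Foias, *Navier–Stokes Equations* (1988), Ch. 14 (energy method for the
linearised equation); R. Temam, *Navier–Stokes Equations* (1979), Ch. II §1 (the steady problem).
-/

set_option linter.dupNamespace false

noncomputable section

namespace Summit.AnomalousDissipation.AnomalousDissipation.Theorems

open MeasureTheory
open scoped InnerProductSpace
open Literature.Analysis.FunctionSpaces

/-- **Pairing identity for the bordered linearised steady operator.** For smooth divergence-free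
`w`, `v : T^d → ℝ^d`, smooth `r : T^d → ℝ`, reals `ν, c, b` and a coordinate `i`,
`∫ ⟪(w·∇)v + (v·∇)w − νΔv + ∇r − c∂ᵢv − b∂ᵢw, v⟫ = ∫ ⟪(v·∇)w, v⟫ + ν‖∇v‖₂² − b ∫ ⟪v, ∂ᵢw⟫`:
the transport term vanishes because `div w = 0`, the pressure term because `div v = 0`, the drift
term `∫ ⟪∂ᵢv, v⟫` by antisymmetry of `∂ᵢ`, and `∫ ⟪Δv, v⟫ = −‖∇v‖₂²` (Green). [folklore] -/
theorem nonresonantSelection_energy_pairing_identity {d : Type*} [Fintype d] [DecidableEq d]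
    {ν c b : ℝ} {w v : UnitAddTorus d → EuclideanSpace ℝ d} {r : UnitAddTorus d → ℝ}
    (hw : Torus.IsSmooth w) (hwdiv : Torus.IsDivFree w) (hv : Torus.IsSmooth v)
    (hvdiv : Torus.IsDivFree v) (hr : Torus.IsSmooth r) (i : d) :
    ∫ x, ⟪Torus.convect w v x + Torus.convect v w x - ν • Torus.laplacian v x +
        Torus.gradient r x - c • Torus.partialDeriv i v x - b • Torus.partialDeriv i w x, v x⟫_ℝ =
      (∫ x, ⟪Torus.convect v w x, v x⟫_ℝ) + ν * Torus.gradNormSq v -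
        b * ∫ x, ⟪v x, Torus.partialDeriv i w x⟫_ℝ := by
  -- integrability of the six pairings (all integrands are smooth on the compact torus)
  have hiA : Integrable (fun x => ⟪Torus.convect w v x, v x⟫_ℝ) volume :=
    ((hw.convect hv).inner hv).integrable
  have hiB : Integrable (fun x => ⟪Torus.convect v w x, v x⟫_ℝ) volume :=
    ((hv.convect hw).inner hv).integrable
  have hiC : Integrable (fun x => ν * ⟪Torus.laplacian v x, v x⟫_ℝ) volume :=
    (hv.laplacian.inner hv).integrable.const_mul ν
  have hiD : Integrable (fun x => ⟪Torus.gradient r x, v x⟫_ℝ) volume :=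
    (hr.gradient.inner hv).integrable
  have hiE : Integrable (fun x => c * ⟪Torus.partialDeriv i v x, v x⟫_ℝ) volume :=
    ((hv.partialDeriv i).inner hv).integrable.const_mul c
  have hiF : Integrable (fun x => b * ⟪Torus.partialDeriv i w x, v x⟫_ℝ) volume :=
    ((hw.partialDeriv i).inner hv).integrable.const_mul b
  have hS2 : Integrable (fun x => ⟪Torus.convect w v x, v x⟫_ℝ + ⟪Torus.convect v w x, v x⟫_ℝ)
      volume := hiA.add hiB
  have hS3 : Integrable (fun x => ⟪Torus.convect w v x, v x⟫_ℝ + ⟪Torus.convect v w x, v x⟫_ℝ -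
      ν * ⟪Torus.laplacian v x, v x⟫_ℝ) volume := hS2.sub hiC
  have hS4 : Integrable (fun x => ⟪Torus.convect w v x, v x⟫_ℝ + ⟪Torus.convect v w x, v x⟫_ℝ -
      ν * ⟪Torus.laplacian v x, v x⟫_ℝ + ⟪Torus.gradient r x, v x⟫_ℝ) volume := hS3.add hiD
  have hS5 : Integrable (fun x => ⟪Torus.convect w v x, v x⟫_ℝ + ⟪Torus.convect v w x, v x⟫_ℝ -
      ν * ⟪Torus.laplacian v x, v x⟫_ℝ + ⟪Torus.gradient r x, v x⟫_ℝ -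
      c * ⟪Torus.partialDeriv i v x, v x⟫_ℝ) volume := hS4.sub hiE
  -- the drift pairing vanishes: `∫ ⟪∂ᵢv, v⟫ = -∫ ⟪v, ∂ᵢv⟫ = -∫ ⟪∂ᵢv, v⟫`
  have h5 : ∫ x, ⟪Torus.partialDeriv i v x, v x⟫_ℝ = 0 := by
    have h := Torus.integral_inner_partialDeriv_eq_neg hv hv i
    have hcomm : ∫ x, ⟪v x, Torus.partialDeriv i v x⟫_ℝ = ∫ x, ⟪Torus.partialDeriv i v x, v x⟫_ℝ :=
      integral_congr_ae (ae_of_all _ fun x => real_inner_comm _ _)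
    rw [hcomm] at h
    linarith
  -- the border pairing, with the slots of the inner product exchanged
  have h6 : ∫ x, ⟪Torus.partialDeriv i w x, v x⟫_ℝ = ∫ x, ⟪v x, Torus.partialDeriv i w x⟫_ℝ :=
    integral_congr_ae (ae_of_all _ fun x => real_inner_comm _ _)
  simp only [inner_sub_left, inner_add_left, real_inner_smul_left]
  rw [integral_sub hS5 hiF, integral_sub hS4 hiE, integral_add hS3 hiD, integral_sub hS2 hiC,
    integral_add hiA hiB, integral_const_mul, integral_const_mul, integral_const_mul,
    Torus.integral_inner_convect_self_right_eq_zero hw hwdiv hv,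
    Torus.integral_inner_gradient_eq_zero_of_isDivFree hv hr hvdiv,
    Torus.integral_inner_laplacian_self_eq_neg_gradNormSq_of_isSmooth hv, h5, h6]
  ring

/-- **Cauchy–Schwarz for the `L²` pairing of two continuous vector fields on the torus**:
`∫ ⟪F, v⟫ ≤ √(∫ ‖F‖²) · √(∫ ‖v‖²)` (pointwise `⟪F, v⟫ ≤ ‖F‖‖v‖`, then Hölder with exponents
`2, 2`, `Torus.integral_mul_le_sqrt_mul_sqrt_of_continuous`). [folklore] -/
theorem nonresonantSelection_energy_integral_inner_le_sqrt_mul_sqrt {d : Type*} [Fintype d]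
    [DecidableEq d] {F v : UnitAddTorus d → EuclideanSpace ℝ d} (hF : Continuous F)
    (hv : Continuous v) :
    ∫ x, ⟪F x, v x⟫_ℝ ≤ Real.sqrt (∫ x, ‖F x‖ ^ 2) * Real.sqrt (∫ x, ‖v x‖ ^ 2) := by
  have h1 : ∫ x, ⟪F x, v x⟫_ℝ ≤ ∫ x, ‖F x‖ * ‖v x‖ :=
    integral_mono (hF.inner hv).integrable_unitAddTorus
      (hF.norm.mul hv.norm).integrable_unitAddTorus fun x => real_inner_le_norm _ _
  exact h1.trans (Torus.integral_mul_le_sqrt_mul_sqrt_of_continuous hF.norm hv.norm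
    (fun x => norm_nonneg _) fun x => norm_nonneg _)

/-- **Energy inequality at the base `(w, c)` (registered stub `stub_linearisedEnergyIneq`).** For
smooth divergence-free `w`, `v` on `T³`, smooth `r`, reals `ν, c, b` and a bound `‖∂ᵢw‖ ≤ G`, with the
bordered residual `F := (w·∇)v + (v·∇)w − νΔv + ∇r − c∂₃v − b∂₃w`:
`ν‖∇v‖₂² ≤ √(∫‖F‖²)·√(∫‖v‖²) + 3G ∫‖v‖² + |b|·|∫ ⟪v, ∂₃w⟫|`. Proof: the pairing identity
`ν‖∇v‖₂² = ∫ ⟪F, v⟫ − ∫ ⟪(v·∇)w, v⟫ + b ∫ ⟪v, ∂₃w⟫`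
(`nonresonantSelection_energy_pairing_identity`), Cauchy–Schwarz for `∫ ⟪F, v⟫`, the production
bound `|∫ ⟪(v·∇)w, v⟫| ≤ (∑ᵢ G) ∫ ‖v‖² = 3G ∫ ‖v‖²` (`Torus.abs_integral_inner_convect_le`), and
`b·X ≤ |b|·|X|`. -/
theorem stub_linearisedEnergyIneq :
    ∀ (ν c b G : ℝ) (w v : UnitAddTorus (Fin 3) → EuclideanSpace ℝ (Fin 3)) (r : UnitAddTorus (Fin 3) → ℝ),
      Torus.IsSmooth w → Torus.IsDivFree w → Torus.IsSmooth v → Torus.IsDivFree v → Torus.IsSmooth r →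
      (∀ (i : Fin 3) x, ‖Torus.partialDeriv i w x‖ ≤ G) →
      ν * Torus.gradNormSq v ≤
        Real.sqrt (∫ x, ‖Torus.convect w v x + Torus.convect v w x - ν • Torus.laplacian v x +
            Torus.gradient r x - c • Torus.partialDeriv (2 : Fin 3) v x -
            b • Torus.partialDeriv (2 : Fin 3) w x‖ ^ 2) * Real.sqrt (∫ x, ‖v x‖ ^ 2) +
        3 * G * (∫ x, ‖v x‖ ^ 2) +
        |b| * |∫ x, inner ℝ (v x) (Torus.partialDeriv (2 : Fin 3) w x)| := by
  intro ν c b G w v r hw hwdiv hv hvdiv hr hG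
  -- the bordered residual is smooth, hence continuous
  have hFs : Torus.IsSmooth (fun x => Torus.convect w v x + Torus.convect v w x -
      ν • Torus.laplacian v x + Torus.gradient r x - c • Torus.partialDeriv (2 : Fin 3) v x -
      b • Torus.partialDeriv (2 : Fin 3) w x) :=
    (((((hw.convect hv).add (hv.convect hw)).sub (hv.laplacian.smul ν)).add hr.gradient).sub
      ((hv.partialDeriv 2).smul c)).sub ((hw.partialDeriv 2).smul b)
  -- (1) the pairing identity
  have hid := nonresonantSelection_energy_pairing_identity (ν := ν) (c := c) (b := b) hw hwdiv hv
    hvdiv hr (2 : Fin 3)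
  -- (2) Cauchy–Schwarz for `∫ ⟪F, v⟫`
  have h1 := nonresonantSelection_energy_integral_inner_le_sqrt_mul_sqrt hFs.continuous hv.continuous
  -- (3) the production term
  have h2 : |∫ x, ⟪Torus.convect v w x, v x⟫_ℝ| ≤ 3 * G * ∫ x, ‖v x‖ ^ 2 := by
    have h := Torus.abs_integral_inner_convect_le (C := fun _ => G) hw hv hG
    have h3 : ∑ _i : Fin 3, G = 3 * G := by
      rw [Fin.sum_univ_three]
      ring
    rwa [h3] at h
  -- (4) the border term
  have h3 : b * ∫ x, ⟪v x, Torus.partialDeriv (2 : Fin 3) w x⟫_ℝ ≤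
      |b| * |∫ x, ⟪v x, Torus.partialDeriv (2 : Fin 3) w x⟫_ℝ| := by
    rw [← abs_mul]
    exact le_abs_self _
  have h2' := (abs_le.1 h2).1
  linarith

end Summit.AnomalousDissipation.AnomalousDissipation.Theorems

end
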